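import Summits.CriticalPhenomena.Ising3DConformalLimit.Theses.MirrorHoelderCompactness
import Summits.CriticalPhenomena.Ising3DConformalLimit.Theorems.HyperoctahedralRPCriticalCorrNineMirrorRP
import Summits.CriticalPhenomena.Ising3DConformalLimit.Theorems.MoebiusLimitExists.Negative.FreePermutations
import Summits.CriticalPhenomena.Ising3DConformalLimit.Theorems.MoebiusLimitExists.Negative.FreeTranslations
import Summits.CriticalPhenomena.Ising3DConformalLimit.Theorems.EnergyNotSigmaSquaredMoebiusLimitExistsMoveIneq
import HarnessLib

/-!
# The RP–Cauchy–Schwarz transfer across the nine lattice mirror families of `ℤ³`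
(route MirrorHoelderCompactness, item stmt-CriticalPhenomena-6155 `MirrorCauchySchwarz`, lemma L2
of the card mirror-hoelder-modulus)

Statement (`mirrorCauchySchwarz_proof`, literally the route decl `MirrorCauchySchwarz`). For each
of the nine mirror families of `ℤ³` at an integer offset `k` — the axis planes `x_i = k`
(`θ : x_i ↦ 2k - x_i`, level `ℓ = x_i - k`), the diagonal planes `x_i - x_j = k`
(`θ : (x_i, x_j) ↦ (x_j + k, x_i - k)`, `ℓ = x_i - x_j - k`) and the anti-diagonal planes
`x_i + x_j = k` (`θ : (x_i, x_j) ↦ (k - x_j, k - x_i)`, `ℓ = x_i + x_j - k`) — and lattice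
configurations `W` (`m` sites), `Y` (`p` sites), `x`, `x'` strictly on the positive side `{ℓ > 0}`,
`(⟨σ_{θx} σ_{θW} σ_Y⟩ − ⟨σ_{θx'} σ_{θW} σ_Y⟩)² ≤ [Q(x,x) − Q(x,x') − Q(x',x) + Q(x',x')] · ⟨σ_{θY} σ_Y⟩`
with `Q(u,v) = ⟨σ_{θu} σ_v σ_{θW} σ_W⟩`, all correlators being the critical infinite-volume ones
`criticalCorr 3` (spin monomials, multiplicities allowed). This is `B(F,G)² ≤ B(F,F) B(G,G)` for the
Osterwalder–Schrader form `B(F,G) = ⟨θF · G⟩`, `F = (σ_x − σ_{x'}) σ_W`, `G = σ_Y`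
(Fröhlich–Israel–Lieb–Simon 1978 §2; Friedli–Velenik 2017 Lemma 10.8).

Proof.
* `mirrorCS_of_rp`: for ANY map `θ` of `ℤ³` and predicate `P` such that the Gram form
  `(a,b) ↦ ⟨∏ σ_{θ z^a} ∏ σ_{z^b}⟩_{β_c}` is positive semidefinite on spin monomials supported in `P`,
  the critical state is `θ`-invariant and `θ` is an involution, the inequality holds: the `3 × 3`
  Gram inequality (`gram_three`) for the blocks `(x, W)`, `(x', W)`, `Y` with coefficients
  `(1, -1, t)` is a nonnegative quadratic polynomial in `t`; its entries are identified by splitting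
  the spin monomials of concatenated configurations (`Fin.prod_univ_add`, `Fin.prod_univ_succ`) and,
  for the two `Y`-first entries, by `θ`-invariance; the discriminant inequality is the claim.
* The three hypotheses for the nine families at offset `k`: each offset mirror is the conjugate
  `θ = τ_v ∘ θ₀ ∘ τ_{-v}` (`v = k e_i`) of a mirror `θ₀` through the origin with level
  `ℓ = ℓ₀ ∘ τ_{-v}` (`axisMirror_conj`, `diagMirror_conj`, `antiMirror_conj`). Reflection
  positivity through the origin mirrors is the landed `criticalCorrNineMirrorRP_proof` (item 1985,
  FILS 1978 Thm. 3.1), transported to offset `k` by the translation invariance of the critical state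
  (`criticalCorr_translate`, Friedli–Velenik Thm. 3.17) in `rp_of_conj`; the origin mirrors are
  signed coordinate permutations, under which the critical state is invariant
  (`criticalCorr_signedPerm`, Friedli–Velenik Exercise 3.14), and conjugation by a translation keeps
  invariance (`inv_of_conj`) and involutivity (`involutive_of_conj`).

References: J. Fröhlich, R. Israel, E. H. Lieb, B. Simon, Comm. Math. Phys. 62 (1978) 1–34, §2–3;
S. Friedli, Y. Velenik, *Statistical Mechanics of Lattice Systems* (CUP 2017), Lemma 10.8,
Thm. 3.17, Exercise 3.14. No definitions are introduced.
-/

noncomputable section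

namespace Summit.CriticalPhenomena.Ising3DConformalLimit.MirrorHoelderCompactnessMirrorCS

open Literature.Probability.LatticeModels
open Summit.CriticalPhenomena.Ising3DConformalLimit.HyperoctahedralRPNineMirror
open Summit.CriticalPhenomena.Ising3DConformalLimit.MoebiusLimitExistsNegative
  (criticalCorr_signedPerm criticalCorr_translate)
open Summit.CriticalPhenomena.Ising3DConformalLimit.Cruxes.InversionUpgradeNormalised.FreeEndpointGaussianClosure
  (mirror_involutive spinMonomial_append_apply)
open Summit.CriticalPhenomena.Ising3DConformalLimit.MoebiusLimitExistsOnlyInteraction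
  (moveIneq_of_forall_quadratic_nonneg)

/-! ### Spin monomials of concatenated configurations -/

/-- `∏ σ` over `a :: u` is `σ_a · ∏ σ_u` (`Fin.prod_univ_succ`). [folklore] -/
theorem spinMonomial_cons_apply {V : Type*} {n : ℕ} (a : V) (u : Fin n → V) (s : SpinConfig V) :
    spinMonomial (Fin.cons a u : Fin (n + 1) → V) s = spinAt a s * spinMonomial u s := by
  simp only [spinMonomial, Fin.prod_univ_succ, Fin.cons_zero, Fin.cons_succ]

/-- `∏ σ` over the image of a concatenation `u ++ v` under a map `f` splits as a product
(`Fin.prod_univ_add`). [folklore] -/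
theorem spinMonomial_map_append_apply {U V : Type*} {m n : ℕ} (f : U → V) (u : Fin m → U)
    (v : Fin n → U) (s : SpinConfig V) :
    spinMonomial (fun j => f (Fin.append u v j)) s =
      spinMonomial (fun j => f (u j)) s * spinMonomial (fun j => f (v j)) s := by
  simp only [spinMonomial]
  rw [Fin.prod_univ_add]
  simp only [Fin.append_left, Fin.append_right]

/-- `∏ σ` over the image of `a :: u` under a map `f` (`Fin.prod_univ_succ`). [folklore] -/
theorem spinMonomial_map_cons_apply {U V : Type*} {n : ℕ} (f : U → V) (a : U) (u : Fin n → U)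
    (s : SpinConfig V) :
    spinMonomial (fun j => f ((Fin.cons a u : Fin (n + 1) → U) j)) s =
      spinAt (f a) s * spinMonomial (fun j => f (u j)) s := by
  simp only [spinMonomial, Fin.prod_univ_succ, Fin.cons_zero, Fin.cons_succ]

/-- Critical correlators of two configurations with the same spin monomial agree (the correlator
is the plus-state expectation of the monomial). [folklore] -/
theorem criticalCorr_eq_of_spinMonomial_eq {n n' : ℕ} {y : Fin n → Site 3} {y' : Fin n' → Site 3}
    (h : spinMonomial y = spinMonomial y') : criticalCorr 3 n y = criticalCorr 3 n' y' := by
  show plusExpect 3 (criticalBeta 3) 0 (spinMonomial y) =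
    plusExpect 3 (criticalBeta 3) 0 (spinMonomial y')
  rw [h]

/-! ### The abstract Gram / Cauchy–Schwarz step -/

/-- **The `3 × 3` Gram inequality** for an abstract reflection-positive pair `(θ, P)`: if the
Gram form `(a, b) ↦ ⟨∏ σ_{θ z^a} ∏ σ_{z^b}⟩_{β_c}` is positive semidefinite on spin monomials
supported in `P`, then for three such monomials `z₀, z₁, z₂` and real `c₀, c₁, c₂` the nine-term
sum `Σ_{a,b} c_a c_b ⟨∏ σ_{θ z_a ++ z_b}⟩_{β_c}` is nonnegative. [cite: FrohlichEtAl1978, §2] -/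
theorem gram_three {θ : Site 3 → Site 3} {P : Site 3 → Prop}
    (hRP : ∀ (m : ℕ) (k : Fin m → ℕ) (z : (a : Fin m) → Fin (k a) → Site 3) (c : Fin m → ℝ),
      (∀ a i, P (z a i)) → 0 ≤ ∑ a, ∑ b, c a * c b *
        criticalCorr 3 (k a + k b) (Fin.append (fun i => θ (z a i)) (z b)))
    {m₀ m₁ m₂ : ℕ} (z₀ : Fin m₀ → Site 3) (z₁ : Fin m₁ → Site 3) (z₂ : Fin m₂ → Site 3)
    (h₀ : ∀ i, P (z₀ i)) (h₁ : ∀ i, P (z₁ i)) (h₂ : ∀ i, P (z₂ i)) (c₀ c₁ c₂ : ℝ) :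
    0 ≤ c₀ * c₀ * criticalCorr 3 (m₀ + m₀) (Fin.append (fun i => θ (z₀ i)) z₀)
        + c₀ * c₁ * criticalCorr 3 (m₀ + m₁) (Fin.append (fun i => θ (z₀ i)) z₁)
        + c₀ * c₂ * criticalCorr 3 (m₀ + m₂) (Fin.append (fun i => θ (z₀ i)) z₂)
      + (c₁ * c₀ * criticalCorr 3 (m₁ + m₀) (Fin.append (fun i => θ (z₁ i)) z₀)
        + c₁ * c₁ * criticalCorr 3 (m₁ + m₁) (Fin.append (fun i => θ (z₁ i)) z₁)
        + c₁ * c₂ * criticalCorr 3 (m₁ + m₂) (Fin.append (fun i => θ (z₁ i)) z₂))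
      + (c₂ * c₀ * criticalCorr 3 (m₂ + m₀) (Fin.append (fun i => θ (z₂ i)) z₀)
        + c₂ * c₁ * criticalCorr 3 (m₂ + m₁) (Fin.append (fun i => θ (z₂ i)) z₁)
        + c₂ * c₂ * criticalCorr 3 (m₂ + m₂) (Fin.append (fun i => θ (z₂ i)) z₂)) := by
  let k : Fin 3 → ℕ := ![m₀, m₁, m₂]
  let z : (a : Fin 3) → Fin (k a) → Site 3 := Fin.cons z₀ (Fin.cons z₁ (Fin.cons z₂ finZeroElim))
  have h : 0 ≤ ∑ a, ∑ b, ![c₀, c₁, c₂] a * ![c₀, c₁, c₂] b * criticalCorr 3 (k a + k b)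
      (Fin.append (fun i => θ (z a i)) (z b)) := by
    refine hRP 3 k z _ fun a => ?_
    fin_cases a
    · exact h₀
    · exact h₁
    · exact h₂
  simp only [Fin.sum_univ_three] at h
  exact h

/-- **RP–Cauchy–Schwarz transfer, abstract form.** Let `θ : ℤ³ → ℤ³` be an involution leaving the
critical state invariant and `P` a half-space such that the Gram form
`(a, b) ↦ ⟨∏ σ_{θ z^a} ∏ σ_{z^b}⟩_{β_c}` is positive semidefinite on spin monomials supported in `P`.
Then for `W`, `Y`, `x`, `x'` in `P`,
`(⟨σ_{θx} σ_{θW} σ_Y⟩ − ⟨σ_{θx'} σ_{θW} σ_Y⟩)² ≤ [Q(x,x) − Q(x,x') − Q(x',x) + Q(x',x')] · ⟨σ_{θY} σ_Y⟩`,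
`Q(u,v) = ⟨σ_{θu} σ_v σ_{θW} σ_W⟩`: the Gram inequality for the blocks `(x,W)`, `(x',W)`, `Y` with
coefficients `(1, -1, t)` and the discriminant in `t` (`moveIneq_of_forall_quadratic_nonneg` of the
MoveIneq file; FILS 1978 §2; Friedli–Velenik 2017 Lemma 10.8). [cite: FrohlichEtAl1978, §2] -/
theorem mirrorCS_of_rp {θ : Site 3 → Site 3} {P : Site 3 → Prop}
    (hRP : ∀ (m : ℕ) (k : Fin m → ℕ) (z : (a : Fin m) → Fin (k a) → Site 3) (c : Fin m → ℝ),
      (∀ a i, P (z a i)) → 0 ≤ ∑ a, ∑ b, c a * c b *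
        criticalCorr 3 (k a + k b) (Fin.append (fun i => θ (z a i)) (z b)))
    (hinv : ∀ (n : ℕ) (y : Fin n → Site 3),
      criticalCorr 3 n (fun i => θ (y i)) = criticalCorr 3 n y)
    (hθ : Function.Involutive θ) (m p : ℕ) (W : Fin m → Site 3) (Y : Fin p → Site 3)
    (x x' : Site 3) (hW : ∀ a, P (W a)) (hY : ∀ b, P (Y b)) (hx : P x) (hx' : P x') :
    (criticalCorr 3 (m + p + 1) (Fin.cons (θ x) (Fin.append (fun a => θ (W a)) Y)) -
        criticalCorr 3 (m + p + 1) (Fin.cons (θ x') (Fin.append (fun a => θ (W a)) Y))) ^ 2 ≤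
      (criticalCorr 3 (m + m + 1 + 1)
            (Fin.cons (θ x) (Fin.cons x (Fin.append (fun a => θ (W a)) W))) -
          criticalCorr 3 (m + m + 1 + 1)
            (Fin.cons (θ x) (Fin.cons x' (Fin.append (fun a => θ (W a)) W))) -
          criticalCorr 3 (m + m + 1 + 1)
            (Fin.cons (θ x') (Fin.cons x (Fin.append (fun a => θ (W a)) W))) +
          criticalCorr 3 (m + m + 1 + 1)
            (Fin.cons (θ x') (Fin.cons x' (Fin.append (fun a => θ (W a)) W)))) *
        criticalCorr 3 (p + p) (Fin.append (fun b => θ (Y b)) Y) := by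
  have hθθ : ∀ y, θ (θ y) = y := hθ
  -- the two `(m+1)`-blocks lie in `P`
  have hxW : ∀ i, P ((Fin.cons x W : Fin (m + 1) → Site 3) i) := fun i =>
    Fin.cases (by simpa using hx) (fun a => by simpa using hW a) i
  have hx'W : ∀ i, P ((Fin.cons x' W : Fin (m + 1) → Site 3) i) := fun i =>
    Fin.cases (by simpa using hx') (fun a => by simpa using hW a) i
  -- block–block entries `Q(u, v)`
  have hQ : ∀ u v : Site 3,
      criticalCorr 3 (m + 1 + (m + 1))
          (Fin.append (fun i => θ ((Fin.cons u W : Fin (m + 1) → Site 3) i)) (Fin.cons v W)) =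
        criticalCorr 3 (m + m + 1 + 1)
          (Fin.cons (θ u) (Fin.cons v (Fin.append (fun a => θ (W a)) W))) := fun u v =>
    criticalCorr_eq_of_spinMonomial_eq (funext fun s => by
      simp only [spinMonomial_append_apply, spinMonomial_map_cons_apply, spinMonomial_cons_apply]
      ring)
  -- block–`Y` entries
  have hBY : ∀ u : Site 3,
      criticalCorr 3 (m + 1 + p)
          (Fin.append (fun i => θ ((Fin.cons u W : Fin (m + 1) → Site 3) i)) Y) =
        criticalCorr 3 (m + p + 1) (Fin.cons (θ u) (Fin.append (fun a => θ (W a)) Y)) := fun u =>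
    criticalCorr_eq_of_spinMonomial_eq (funext fun s => by
      simp only [spinMonomial_append_apply, spinMonomial_map_cons_apply, spinMonomial_cons_apply]
      ring)
  -- `Y`–block entries: mirror invariance of the critical state and `θ ∘ θ = id`
  have hYB : ∀ u : Site 3,
      criticalCorr 3 (p + (m + 1))
          (Fin.append (fun i => θ (Y i)) (Fin.cons u W : Fin (m + 1) → Site 3)) =
        criticalCorr 3 (m + p + 1) (Fin.cons (θ u) (Fin.append (fun a => θ (W a)) Y)) := fun u => by
    rw [← hinv _ (Fin.append (fun i => θ (Y i)) (Fin.cons u W))]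
    exact criticalCorr_eq_of_spinMonomial_eq (funext fun s => by
      simp only [spinMonomial_map_append_apply, spinMonomial_append_apply,
        spinMonomial_map_cons_apply, spinMonomial_cons_apply, hθθ]
      ring)
  refine moveIneq_of_forall_quadratic_nonneg fun t => ?_
  have h := gram_three hRP (Fin.cons x W) (Fin.cons x' W) Y hxW hx'W hY 1 (-1) t
  rw [hQ, hQ, hQ, hQ, hBY, hBY, hYB, hYB] at h
  linarith

/-! ### Conjugating an origin mirror by a lattice translation -/

/-- **Reflection positivity at an offset.** If the Gram form of `θ₀` is positive semidefinite on
monomials supported in `{ℓ₀ > 0}`, then so is the Gram form of the conjugate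
`θ = τ_v ∘ θ₀ ∘ τ_{-v}` on monomials supported in `{ℓ > 0}`, `ℓ = ℓ₀ ∘ τ_{-v}`: translate every
configuration by `-v` and use the translation invariance of the critical state
(`criticalCorr_translate`, Friedli–Velenik 2017 Thm. 3.17). [cite: FriedliVelenik2017, Thm. 3.17] -/
theorem rp_of_conj {θ₀ θ : Site 3 → Site 3} {ℓ₀ ℓ : Site 3 → ℤ} (v : Site 3)
    (hθ : ∀ x, θ x = θ₀ (x - v) + v) (hℓ : ∀ x, ℓ x = ℓ₀ (x - v))
    (hRP₀ : ∀ (m : ℕ) (k : Fin m → ℕ) (z : (a : Fin m) → Fin (k a) → Site 3) (c : Fin m → ℝ),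
      (∀ a i, 0 < ℓ₀ (z a i)) → 0 ≤ ∑ a, ∑ b, c a * c b *
        criticalCorr 3 (k a + k b) (Fin.append (fun i => θ₀ (z a i)) (z b)))
    (m : ℕ) (k : Fin m → ℕ) (z : (a : Fin m) → Fin (k a) → Site 3) (c : Fin m → ℝ)
    (hz : ∀ a i, 0 < ℓ (z a i)) :
    0 ≤ ∑ a, ∑ b, c a * c b *
      criticalCorr 3 (k a + k b) (Fin.append (fun i => θ (z a i)) (z b)) := by
  have h := hRP₀ m k (fun a i => z a i - v) c (fun a i => by rw [← hℓ]; exact hz a i)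
  refine h.trans_eq (Finset.sum_congr rfl fun a _ => Finset.sum_congr rfl fun b _ => ?_)
  congr 1
  rw [← criticalCorr_translate (Fin.append (fun i => θ₀ (z a i - v)) (fun i => z b i - v)) v]
  congr 1
  funext j
  refine Fin.addCases (fun l => ?_) (fun r => ?_) j
  · simp only [Fin.append_left, hθ]
  · simp only [Fin.append_right, sub_add_cancel]

/-- Invariance of the critical state under the conjugate `θ = τ_v ∘ θ₀ ∘ τ_{-v}` of a
state-preserving map `θ₀` by a lattice translation (`criticalCorr_translate`).
[cite: FriedliVelenik2017, Thm. 3.17] -/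
theorem inv_of_conj {θ₀ θ : Site 3 → Site 3} (v : Site 3) (hθ : ∀ x, θ x = θ₀ (x - v) + v)
    (hinv₀ : ∀ (n : ℕ) (y : Fin n → Site 3),
      criticalCorr 3 n (fun i => θ₀ (y i)) = criticalCorr 3 n y)
    (n : ℕ) (y : Fin n → Site 3) : criticalCorr 3 n (fun i => θ (y i)) = criticalCorr 3 n y := by
  simp only [hθ]
  rw [criticalCorr_translate (fun i => θ₀ (y i - v)) v, hinv₀ n (fun i => y i - v)]
  have h : (fun i => y i - v) = fun i => y i + -v := funext fun i => sub_eq_add_neg _ _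
  rw [h, criticalCorr_translate]

/-- The conjugate of an involution by a translation is an involution. [folklore] -/
theorem involutive_of_conj {θ₀ θ : Site 3 → Site 3} (v : Site 3) (hθ : ∀ x, θ x = θ₀ (x - v) + v)
    (h₀ : Function.Involutive θ₀) : Function.Involutive θ := fun x => by
  rw [hθ, hθ, add_sub_cancel_right, h₀, sub_add_cancel]

/-- Invariance of the critical state under a map that is a signed coordinate permutation
(`criticalCorr_signedPerm`, Friedli–Velenik 2017 Exercise 3.14).
[cite: FriedliVelenik2017, Exercise 3.14, p. 115] -/
theorem inv_of_eq_signedPerm {θ₀ : Site 3 → Site 3} (π : Equiv.Perm (Fin 3)) (ε : Fin 3 → ℤˣ)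
    (h : θ₀ = ⇑(Site.signedPerm π ε)) (n : ℕ) (y : Fin n → Site 3) :
    criticalCorr 3 n (fun i => θ₀ (y i)) = criticalCorr 3 n y := by
  subst h
  exact criticalCorr_signedPerm π ε y

/-! ### The nine mirror families at offset `k` as conjugates of the origin mirrors -/

/-- Axis family: `x_i ↦ 2k - x_i` is the origin mirror `x_i ↦ -x_i` conjugated by the
translation `k e_i`. [folklore] -/
theorem axisMirror_conj (i : Fin 3) (k : ℤ) (x : Site 3) :
    Function.update x i (2 * k - x i) =
      (fun y : Site 3 => Function.update y i (-y i)) (x - Pi.single i k) + Pi.single i k := by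
  funext l
  by_cases hl : l = i
  · subst hl
    simp only [Function.update_self, Pi.add_apply, Pi.sub_apply, Pi.single_eq_same]
    ring
  · simp only [Function.update_of_ne hl, Pi.add_apply, Pi.sub_apply, Pi.single_eq_of_ne hl,
      sub_zero, add_zero]

/-- The origin axis mirror `x_i ↦ -x_i` is the signed permutation `(1, ε)` with `ε_i = -1`.
[folklore] -/
theorem axisMirror_eq_signedPerm (i : Fin 3) :
    (fun y : Site 3 => Function.update y i (-y i)) =
      ⇑(Site.signedPerm (Equiv.refl (Fin 3)) (Function.update 1 i (-1))) := by
  funext y l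
  rw [Site.signedPerm_apply, Equiv.refl_symm, Equiv.refl_apply]
  by_cases hl : l = i
  · subst hl
    simp
  · simp [Function.update_of_ne hl]

/-- Diagonal family: `(x_i, x_j) ↦ (x_j + k, x_i - k)` is the swap of the coordinates `i, j`
conjugated by the translation `k e_i`. [folklore] -/
theorem diagMirror_conj {i j : Fin 3} (hij : i ≠ j) (k : ℤ) (x : Site 3) :
    Function.update (Function.update x i (x j + k)) j (x i - k) =
      (fun y : Site 3 => y ∘ Equiv.swap i j) (x - Pi.single i k) + Pi.single i k := by
  funext l
  simp only [Pi.add_apply, Function.comp_apply, Pi.sub_apply]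
  by_cases hlj : l = j
  · rw [hlj, Function.update_self, Equiv.swap_apply_right, Pi.single_eq_same,
      Pi.single_eq_of_ne hij.symm]
    ring
  · rw [Function.update_of_ne hlj]
    by_cases hli : l = i
    · rw [hli, Function.update_self, Equiv.swap_apply_left, Pi.single_eq_same,
        Pi.single_eq_of_ne hij.symm]
      ring
    · rw [Function.update_of_ne hli, Equiv.swap_apply_of_ne_of_ne hli hlj,
        Pi.single_eq_of_ne hli]
      ring

/-- Anti-diagonal family: `(x_i, x_j) ↦ (k - x_j, k - x_i)` is the origin anti-diagonal mirror
`(x_i, x_j) ↦ (-x_j, -x_i)` conjugated by the translation `k e_i`. [folklore] -/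
theorem antiMirror_conj {i j : Fin 3} (hij : i ≠ j) (k : ℤ) (x : Site 3) :
    Function.update (Function.update x i (k - x j)) j (k - x i) =
      (fun y : Site 3 => Function.update (Function.update y i (-y j)) j (-y i)) (x - Pi.single i k)
        + Pi.single i k := by
  funext l
  simp only [Pi.add_apply, Pi.sub_apply]
  by_cases hlj : l = j
  · rw [hlj, Function.update_self, Function.update_self, Pi.single_eq_same,
      Pi.single_eq_of_ne hij.symm]
    ring
  · rw [Function.update_of_ne hlj, Function.update_of_ne hlj]
    by_cases hli : l = i
    · rw [hli, Function.update_self, Function.update_self, Pi.single_eq_same,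
        Pi.single_eq_of_ne hij.symm]
      ring
    · rw [Function.update_of_ne hli, Function.update_of_ne hli, Pi.sub_apply,
        Pi.single_eq_of_ne hli]
      ring

/-! ### The route item -/

open Summit.CriticalPhenomena.Ising3DConformalLimit.Theses.HyperoctahedralRP
  (CriticalCorrNineMirrorRP) in
/-- Nine-mirror reflection positivity through the origin (the landed item 1985,
`criticalCorrNineMirrorRP_proof`), with the quantifiers of the route decl exposed.
[cite: FrohlichEtAl1978, §3 Thm 3.1] -/
theorem nineMirrorRP_origin (θ : Site 3 → Site 3) (ℓ : Site 3 → ℤ)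
    (h : ∃ i j : Fin 3, i ≠ j ∧ ((θ = fun x => Function.update x i (-x i)) ∧ (ℓ = fun x => x i) ∨
      (θ = fun x => x ∘ Equiv.swap i j) ∧ (ℓ = fun x => x i - x j) ∨
      (θ = fun x => Function.update (Function.update x i (-x j)) j (-x i)) ∧
        (ℓ = fun x => x i + x j)))
    (m : ℕ) (k : Fin m → ℕ) (z : (a : Fin m) → Fin (k a) → Site 3) (c : Fin m → ℝ)
    (hz : ∀ a i, 0 < ℓ (z a i)) :
    0 ≤ ∑ a, ∑ b, c a * c b *
      criticalCorr 3 (k a + k b) (Fin.append (fun i => θ (z a i)) (z b)) := by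
  have hRP : CriticalCorrNineMirrorRP := criticalCorrNineMirrorRP_proof
  exact hRP θ ℓ h m k z c hz

open Summit.CriticalPhenomena.Ising3DConformalLimit.Theses.MirrorHoelderCompactness in
/-- **`MirrorCauchySchwarz`** (item stmt-CriticalPhenomena-6155, lemma L2 of the card
mirror-hoelder-modulus): the RP–Cauchy–Schwarz transfer
`(⟨σ_{θx} σ_{θW} σ_Y⟩ − ⟨σ_{θx'} σ_{θW} σ_Y⟩)² ≤ [Q(x,x) − Q(x,x') − Q(x',x) + Q(x',x')] · ⟨σ_{θY} σ_Y⟩`,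
`Q(u,v) = ⟨σ_{θu} σ_v σ_{θW} σ_W⟩`, for each of the nine lattice mirror families of `ℤ³` at every
integer offset `k` (axis planes `x_i = k`, diagonal planes `x_i - x_j = k`, anti-diagonal planes
`x_i + x_j = k`) and `W, Y, x, x'` strictly on the positive side. Proof: `mirrorCS_of_rp` with the
Gram positivity transported from the origin mirrors (`criticalCorrNineMirrorRP_proof`, FILS 1978
Thm. 3.1) by translation invariance (`rp_of_conj`), mirror invariance of the critical state
(`criticalCorr_signedPerm` + `criticalCorr_translate`) and involutivity of the mirrors.
[cite: FrohlichEtAl1978, §2] -/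
theorem mirrorCauchySchwarz_proof : MirrorCauchySchwarz := by
  intro θ ℓ hθℓ m p W Y x x' hW hY hx hx'
  obtain ⟨i, j, k, hij, ⟨hθ, hℓ⟩ | ⟨hθ, hℓ⟩ | ⟨hθ, hℓ⟩⟩ := hθℓ
  · -- axis planes `x_i = k`
    have hθ' : ∀ y, θ y = (fun y : Site 3 => Function.update y i (-y i)) (y - Pi.single i k) +
        Pi.single i k := fun y => by
      rw [hθ]
      exact axisMirror_conj i k y
    have hℓ' : ∀ y, ℓ y = (fun y : Site 3 => y i) (y - Pi.single i k) := fun y => by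
      rw [hℓ]
      simp
    exact mirrorCS_of_rp (P := fun y => 0 < ℓ y)
      (rp_of_conj (Pi.single i k) hθ' hℓ'
        (nineMirrorRP_origin _ _ ⟨i, j, hij, Or.inl ⟨rfl, rfl⟩⟩))
      (inv_of_conj (Pi.single i k) hθ' (inv_of_eq_signedPerm _ _ (axisMirror_eq_signedPerm i)))
      (involutive_of_conj (Pi.single i k) hθ' (mirror_involutive i)) m p W Y x x' hW hY hx hx'
  · -- diagonal planes `x_i - x_j = k`
    have hθ' : ∀ y, θ y = (fun y : Site 3 => y ∘ Equiv.swap i j) (y - Pi.single i k) +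
        Pi.single i k := fun y => by
      rw [hθ]
      exact diagMirror_conj hij k y
    have hℓ' : ∀ y, ℓ y = (fun y : Site 3 => y i - y j) (y - Pi.single i k) := fun y => by
      rw [hℓ]
      simp only [Pi.sub_apply, Pi.single_eq_same, Pi.single_eq_of_ne hij.symm]
      ring
    exact mirrorCS_of_rp (P := fun y => 0 < ℓ y)
      (rp_of_conj (Pi.single i k) hθ' hℓ'
        (nineMirrorRP_origin _ _ ⟨i, j, hij, Or.inr (Or.inl ⟨rfl, rfl⟩)⟩))
      (inv_of_conj (Pi.single i k) hθ'
        (inv_of_eq_signedPerm _ _ (swapMirror_eq_signedPerm i j)))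
      (involutive_of_conj (Pi.single i k) hθ' (swapMirror_involutive i j))
      m p W Y x x' hW hY hx hx'
  · -- anti-diagonal planes `x_i + x_j = k`
    have hθ' : ∀ y, θ y =
        (fun y : Site 3 => Function.update (Function.update y i (-y j)) j (-y i))
          (y - Pi.single i k) + Pi.single i k := fun y => by
      rw [hθ]
      exact antiMirror_conj hij k y
    have hℓ' : ∀ y, ℓ y = (fun y : Site 3 => y i + y j) (y - Pi.single i k) := fun y => by
      rw [hℓ]
      simp only [Pi.sub_apply, Pi.single_eq_same, Pi.single_eq_of_ne hij.symm]
      ring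
    exact mirrorCS_of_rp (P := fun y => 0 < ℓ y)
      (rp_of_conj (Pi.single i k) hθ' hℓ'
        (nineMirrorRP_origin _ _ ⟨i, j, hij, Or.inr (Or.inr ⟨rfl, rfl⟩)⟩))
      (inv_of_conj (Pi.single i k) hθ'
        (inv_of_eq_signedPerm _ _ (antiMirror_eq_signedPerm hij)))
      (involutive_of_conj (Pi.single i k) hθ' (antiMirror_involutive hij))
      m p W Y x x' hW hY hx hx'

end Summit.CriticalPhenomena.Ising3DConformalLimit.MirrorHoelderCompactnessMirrorCS

end
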